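import Summits.Ventures.PercRepro.S1ChainKill

/-!
# PercRepro — THE INTERSECTING PAIRS OF A TRIANGLE FAMILY (p2, gen 23; SUBCLAIM-S1 §6.8 (v))

A family `𝒯` of `r` three-sets whose union has `u` points has `δ = 3r − u` incidences beyond the first
(`Σ_x (a_x − 1) = δ` over the union, `a_x` the number of members through `x`), and the ordered pairs of members
meeting in a point are counted by `Σ_x a_x (a_x − 1) ≤ δ(δ + 1)` — so a chain with a large union has few
intersecting pairs, and the Bonferroni kill can charge the overlap `C(n − 6, p − 6)` to every pair and the difference
`C(n − 5, p − 5) − C(n − 6, p − 6)` to at most `δ(δ + 1)/2` of them.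

* `sum_ncard_inter_le_delta` — the double count `Σ_{T ≠ T'} |T ∩ T'| ≤ δ(δ + 1)`;
* **`midCount_ge_K7_kill_pairs`** — the kill of a triangle family with the per-pair overlaps.
Axioms: standard.
-/

open scoped Matroid

namespace PercRepro

namespace S1

open Set

variable {α : Type}

/-- **The double count of the intersecting pairs**: for a finite family `𝒯` of finite sets of size `3` with union
of size `u`, `Σ_{T ∈ 𝒯} Σ_{T' ≠ T} |T ∩ T'| ≤ δ(δ + 1)` with `δ = 3·|𝒯| − u`. -/
theorem sum_ncard_inter_le_delta (𝒯 : Finset (Set α)) (hfin : ∀ T ∈ 𝒯, T.Finite)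
    (h3 : ∀ T ∈ 𝒯, T.ncard = 3) {u : ℕ} (hu : (⋃ T ∈ 𝒯, T).ncard = u) :
    ∑ T ∈ 𝒯, ∑ T' ∈ 𝒯.erase T, (T ∩ T').ncard ≤ (3 * 𝒯.card - u) * (3 * 𝒯.card - u + 1) := by
  classical
  set U : Set α := ⋃ T ∈ 𝒯, T with hU
  have hUfin : U.Finite := Set.Finite.biUnion 𝒯.finite_toSet (fun T hT => hfin T hT)
  set Uf := hUfin.toFinset with hUf
  have hmemUf : ∀ x, x ∈ Uf ↔ ∃ T ∈ 𝒯, x ∈ T := fun x => by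
    rw [hUf, Set.Finite.mem_toFinset, hU, Set.mem_iUnion₂]
    simp only [exists_prop]
  have hTU : ∀ T ∈ 𝒯, T ⊆ U := fun T hT x hx => Set.mem_iUnion₂.2 ⟨T, hT, hx⟩
  -- the multiplicity of a point
  set a : α → ℕ := fun x => (𝒯.filter (fun T => x ∈ T)).card with ha
  -- (a) `|T| = #{x ∈ Uf : x ∈ T}` and `|T ∩ T'| = #{x ∈ Uf : x ∈ T ∧ x ∈ T'}`
  have hcardT : ∀ T ∈ 𝒯, T.ncard = (Uf.filter (fun x => x ∈ T)).card := by
    intro T hT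
    rw [Set.ncard_eq_toFinset_card T (hfin T hT)]
    congr 1
    ext x
    rw [Set.Finite.mem_toFinset, Finset.mem_filter, hmemUf]
    exact ⟨fun hx => ⟨⟨T, hT, hx⟩, hx⟩, fun hx => hx.2⟩
  have hcardI : ∀ T ∈ 𝒯, ∀ T' ∈ 𝒯, (T ∩ T').ncard = (Uf.filter (fun x => x ∈ T ∧ x ∈ T')).card := by
    intro T hT T' hT'
    rw [Set.ncard_eq_toFinset_card (T ∩ T') ((hfin T hT).subset Set.inter_subset_left)]
    congr 1
    ext x
    rw [Set.Finite.mem_toFinset, Finset.mem_filter, hmemUf, Set.mem_inter_iff]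
    exact ⟨fun hx => ⟨⟨T, hT, hx.1⟩, hx⟩, fun hx => hx.2⟩
  -- (c) `Σ_T |T| = Σ_x a x`
  have hsumT : ∑ T ∈ 𝒯, T.ncard = ∑ x ∈ Uf, a x := by
    calc ∑ T ∈ 𝒯, T.ncard = ∑ T ∈ 𝒯, ∑ x ∈ Uf, (if x ∈ T then 1 else 0) := by
          apply Finset.sum_congr rfl
          intro T hT
          rw [hcardT T hT, Finset.card_filter]
      _ = ∑ x ∈ Uf, ∑ T ∈ 𝒯, (if x ∈ T then 1 else 0) := Finset.sum_comm
      _ = ∑ x ∈ Uf, a x := by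
          apply Finset.sum_congr rfl
          intro x _
          rw [ha]; simp only
          rw [Finset.card_filter]
  -- (d) `Σ_T Σ_{T' ≠ T} |T ∩ T'| = Σ_x a x · (a x − 1)`
  have hsumI : ∑ T ∈ 𝒯, ∑ T' ∈ 𝒯.erase T, (T ∩ T').ncard = ∑ x ∈ Uf, a x * (a x - 1) := by
    calc ∑ T ∈ 𝒯, ∑ T' ∈ 𝒯.erase T, (T ∩ T').ncard
        = ∑ T ∈ 𝒯, ∑ T' ∈ 𝒯.erase T, ∑ x ∈ Uf, (if x ∈ T ∧ x ∈ T' then 1 else 0) := by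
          apply Finset.sum_congr rfl
          intro T hT
          apply Finset.sum_congr rfl
          intro T' hT'
          rw [hcardI T hT T' (Finset.mem_of_mem_erase hT'), Finset.card_filter]
      _ = ∑ x ∈ Uf, ∑ T ∈ 𝒯, ∑ T' ∈ 𝒯.erase T, (if x ∈ T ∧ x ∈ T' then 1 else 0) := by
          rw [Finset.sum_comm]
          apply Finset.sum_congr rfl
          intro T _
          exact Finset.sum_comm
      _ = ∑ x ∈ Uf, ∑ T ∈ 𝒯, (if x ∈ T then ((𝒯.erase T).filter (fun T' => x ∈ T')).card else 0) := by
          apply Finset.sum_congr rfl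
          intro x _
          apply Finset.sum_congr rfl
          intro T _
          by_cases hxT : x ∈ T
          · rw [if_pos hxT, Finset.card_filter]
            apply Finset.sum_congr rfl
            intro T' _
            simp only [hxT, true_and]
          · rw [if_neg hxT]
            apply Finset.sum_eq_zero
            intro T' _
            simp only [hxT, false_and, if_false]
      _ = ∑ x ∈ Uf, ∑ T ∈ 𝒯.filter (fun T => x ∈ T), ((𝒯.filter (fun T => x ∈ T)).erase T).card := by
          apply Finset.sum_congr rfl
          intro x _
          rw [Finset.sum_filter]
          apply Finset.sum_congr rfl
          intro T _
          by_cases hxT : x ∈ T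
          · rw [if_pos hxT, if_pos hxT, Finset.filter_erase]
          · rw [if_neg hxT, if_neg hxT]
      _ = ∑ x ∈ Uf, a x * (a x - 1) := by
          apply Finset.sum_congr rfl
          intro x _
          rw [ha]; simp only
          rw [Finset.sum_congr rfl (fun T hT => Finset.card_erase_of_mem hT), Finset.sum_const, smul_eq_mul]
  -- (e) `Σ_x (a x − 1) = 3r − u`
  have hapos : ∀ x ∈ Uf, 1 ≤ a x := by
    intro x hx
    obtain ⟨T, hT, hxT⟩ := (hmemUf x).1 hx
    rw [ha]; simp only
    exact Finset.card_pos.2 ⟨T, Finset.mem_filter.2 ⟨hT, hxT⟩⟩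
  have hsum3 : ∑ T ∈ 𝒯, T.ncard = 3 * 𝒯.card := by
    rw [Finset.sum_congr rfl h3, Finset.sum_const, smul_eq_mul, mul_comm]
  have hUcard : Uf.card = u := by rw [hUf, ← Set.ncard_eq_toFinset_card _ hUfin, hu]
  set δ := 3 * 𝒯.card - u with hδ
  have hδsum : ∑ x ∈ Uf, (a x - 1) = δ := by
    have h1 : ∑ x ∈ Uf, (a x - 1) + ∑ x ∈ Uf, 1 = ∑ x ∈ Uf, a x := by
      rw [← Finset.sum_add_distrib]
      apply Finset.sum_congr rfl
      intro x hx
      have := hapos x hx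
      omega
    rw [Finset.sum_const, smul_eq_mul, mul_one, hUcard, ← hsumT, hsum3] at h1
    omega
  -- (f) `Σ_x a x (a x − 1) ≤ δ(δ + 1)`: termwise `a x − 1 ≤ δ`
  have hterm : ∀ x ∈ Uf, a x * (a x - 1) ≤ (a x - 1) * δ + (a x - 1) := by
    intro x hx
    have hle : a x - 1 ≤ δ := by
      rw [← hδsum]
      exact Finset.single_le_sum (f := fun y => a y - 1) (fun y _ => Nat.zero_le _) hx
    have h1 := hapos x hx
    have e : a x * (a x - 1) = (a x - 1) * (a x - 1) + (a x - 1) := by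
      have : a x = (a x - 1) + 1 := by omega
      rw [this]; simp only [Nat.add_sub_cancel]; ring
    rw [e]
    have := Nat.mul_le_mul_left (a x - 1) hle
    omega
  calc ∑ T ∈ 𝒯, ∑ T' ∈ 𝒯.erase T, (T ∩ T').ncard = ∑ x ∈ Uf, a x * (a x - 1) := hsumI
    _ ≤ ∑ x ∈ Uf, ((a x - 1) * δ + (a x - 1)) := Finset.sum_le_sum hterm
    _ = (∑ x ∈ Uf, (a x - 1)) * δ + ∑ x ∈ Uf, (a x - 1) := by
        rw [Finset.sum_add_distrib, Finset.sum_mul]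
    _ = δ * (δ + 1) := by rw [hδsum]; ring


/-- **THE KILL OF A TRIANGLE FAMILY WITH THE PER-PAIR OVERLAPS**: for a family `𝒯` of `r` triangles of a core with
(C1)–(C3) whose union has `u` points (`δ = 3r − u`, `p ≥ 6`),
`7560·(Σ_{j=5}^{p−1} C(n, j) + r·C(n − 3, p − 3)) ≤ 7560·#Y(p, 4) + R₃ + R₄ + 7560·(C(r, 2)·C(n − 6, p − 6) + (δ(δ + 1)/2)·(C(n − 5, p − 5) − C(n − 6, p − 6)))`
— two triangles overlap in `C(n − 6, p − 6)` `p`-sets, or `C(n − 5, p − 5)` when they meet, and at most `δ(δ + 1)/2`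
pairs meet (`sum_ncard_inter_le_delta`). -/
theorem midCount_ge_K7_kill_pairs (M : Matroid α) [M.Finite]
    (hcirc : ∀ C, M.IsCircuit C → 3 ≤ C.encard)
    (hline : ∀ L ⊆ M.E, M.eRk L ≤ 2 → L.ncard ≤ 3) (hplane : ∀ P ⊆ M.E, M.eRk P ≤ 3 → P.ncard ≤ 6)
    (hten : ∀ X ⊆ M.E, M.eRk X ≤ 4 → X.ncard ≤ 10) {d : ℕ} (hd : M.E.encard = M.eRank + d) (p : ℕ) (hp : 6 ≤ p)
    (hn6 : 6 ≤ M.E.ncard) (𝒯 : Finset (Set α)) (h𝒯 : ∀ C ∈ 𝒯, M.IsCircuit C ∧ C.ncard = 3) {u : ℕ}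
    (hu : (⋃ T ∈ 𝒯, T).ncard = u) :
    7560 * (∑ j ∈ Finset.Ico 5 p, M.E.ncard.choose j + 𝒯.card * (M.E.ncard - 3).choose (p - 3)) ≤
      7560 * Matroid.midCount M p 4 +
      10584 * ({C : Set α | M.IsCircuit C ∧ C.ncard = 3}.ncard * (M.E.ncard - 3) +
        {C : Set α | M.IsCircuit C ∧ C.ncard = 4}.ncard) +
      (RSK 10 * ({C : Set α | M.IsCircuit C ∧ C.ncard = 3}.ncard * (M.E.ncard - 3).choose 2 +
        {C : Set α | M.IsCircuit C ∧ C.ncard = 4}.ncard * (M.E.ncard - 4) +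
        {C : Set α | M.IsCircuit C ∧ C.ncard = 5}.ncard) +
      (RBK 10 - RSK 10) * ({C : Set α | M.IsCircuit C ∧ C.ncard = 3}.ncard * (min (5 * d) M.E.ncard - 3).choose 2 +
        {C : Set α | M.IsCircuit C ∧ C.ncard = 4}.ncard * (min (5 * d) M.E.ncard - 4) +
        {C : Set α | M.IsCircuit C ∧ C.ncard = 5}.ncard)) +
      7560 * (𝒯.card.choose 2 * (M.E.ncard - 6).choose (p - 6) +
        ((3 * 𝒯.card - u) * (3 * 𝒯.card - u + 1) / 2) *
          ((M.E.ncard - 5).choose (p - 5) - (M.E.ncard - 6).choose (p - 6))) := by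
  classical
  have hk : (3 : ℕ) ≤ p := by omega
  have hY3 := five_mul_ncard_rankLe3_ge_five_le M hcirc hline hplane
  have hY2 := ncard_rankEq4_ge_five_le_K M hcirc hline hplane hten hd
  have hEfin : M.E.Finite := M.ground_finite
  set Ef := hEfin.toFinset with hEf
  -- the sets with `5 ≤ |A| ≤ p − 1`
  set 𝓑 : ℕ → Finset (Set α) := fun j => (Ef.powersetCard j).image (fun s : Finset α => (s : Set α)) with h𝓑
  have h𝓑card : ∀ j, (𝓑 j).card = M.E.ncard.choose j := fun j => by
    rw [h𝓑]; exact card_image_powersetCard hEfin j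
  have hmem𝓑 : ∀ j A, A ∈ 𝓑 j ↔ A ⊆ M.E ∧ A.ncard = j := fun j A =>
    mem_image_powersetCard_iff hEfin j A
  have hdisj : ((Finset.Ico 5 p : Finset ℕ) : Set ℕ).PairwiseDisjoint 𝓑 := by
    intro i _ j _ hij
    rw [Function.onFun, Finset.disjoint_left]
    intro A hA hA'
    rw [hmem𝓑] at hA hA'
    exact hij (hA.2.symm.trans hA'.2)
  set W := (Finset.Ico 5 p).biUnion 𝓑 with hW
  have hWcard : W.card = ∑ j ∈ Finset.Ico 5 p, M.E.ncard.choose j := by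
    rw [hW, Finset.card_biUnion hdisj]
    exact Finset.sum_congr rfl (fun j _ => h𝓑card j)
  have hmemW : ∀ A ∈ W, A ⊆ M.E ∧ 5 ≤ A.ncard ∧ A.ncard < p := by
    intro A hA
    rw [hW, Finset.mem_biUnion] at hA
    obtain ⟨j, hj, hAj⟩ := hA
    rw [Finset.mem_Ico] at hj
    rw [hmem𝓑] at hAj
    exact ⟨hAj.1, by omega, by omega⟩
  -- the kill: the `p`-sets through the triangles of `𝒯`
  set Kf : Set α → Finset (Set α) := fun C => oversets hEfin C (p - 3) with hKf
  set KK := 𝒯.biUnion Kf with hKK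
  have hmemK : ∀ A ∈ KK, A ⊆ M.E ∧ A.ncard = p ∧ ∃ C ∈ 𝒯, C ⊆ A := by
    intro A hA
    rw [hKK, Finset.mem_biUnion] at hA
    obtain ⟨C, hC, hAC⟩ := hA
    have hCE : C ⊆ M.E := (h𝒯 C hC).1.subset_ground
    have hcard := ncard_of_mem_oversets hEfin hCE (p - 3) hAC
    rw [hKf] at hAC
    rw [mem_oversets hEfin hCE] at hAC
    refine ⟨hAC.2.1, ?_, C, hC, hAC.1⟩
    rw [hcard, (h𝒯 C hC).2]
    omega
  set o6 := (M.E.ncard - 6).choose (p - 6) with ho6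
  set o5 := (M.E.ncard - 5).choose (p - 5) with ho5
  have ho56 : o6 ≤ o5 := by
    rw [ho5, ho6, show M.E.ncard - 5 = (M.E.ncard - 6) + 1 by omega, show p - 5 = (p - 6) + 1 by omega,
      Nat.choose_succ_succ]
    exact Nat.le_add_right _ _
  -- the per-pair overlap: `C(n − 6, p − 6)` for disjoint triangles, `C(n − 5, p − 5)` for meeting ones
  have hov : ∀ C ∈ 𝒯, ∀ C' ∈ 𝒯, C ≠ C' → (Kf C ∩ Kf C').card ≤ o6 + (C ∩ C').ncard * (o5 - o6) := by
    intro C hC C' hC' hne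
    have hCE : C ⊆ M.E := (h𝒯 C hC).1.subset_ground
    have hC'E : C' ⊆ M.E := (h𝒯 C' hC').1.subset_ground
    have hCfin : C.Finite := hEfin.subset hCE
    have hC'fin : C'.Finite := hEfin.subset hC'E
    have hi := ncard_inter_le_one_of_triangles M (fun L hL hr => hline L hL hr.le) (h𝒯 C hC) (h𝒯 C' hC') hne
    have hunion := Set.ncard_union_add_ncard_inter C C' hCfin hC'fin
    rw [(h𝒯 C hC).2, (h𝒯 C' hC').2] at hunion
    set X := C ∪ C' with hX
    have hXE : X ⊆ M.E := Set.union_subset hCE hC'E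
    have hsub : Kf C ∩ Kf C' ⊆ oversets hEfin X (p - X.ncard) := by
      intro Q hQ
      rw [Finset.mem_inter] at hQ
      have hQcard := ncard_of_mem_oversets hEfin hCE (p - 3) hQ.1
      rw [hKf] at hQ
      simp only at hQ
      rw [mem_oversets hEfin hCE] at hQ
      have hQ2 := hQ.2
      rw [mem_oversets hEfin hC'E] at hQ2
      rw [mem_oversets hEfin hXE]
      have hXQ : X ⊆ Q := Set.union_subset hQ.1.1 hQ2.1
      refine ⟨hXQ, hQ.1.2.1, ?_⟩
      have hQfin : Q.Finite := hEfin.subset hQ.1.2.1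
      rw [Set.ncard_sdiff hXQ (hQfin.subset hXQ), hQcard, (h𝒯 C hC).2]
      omega
    have hcard : (Kf C ∩ Kf C').card ≤ (M.E.ncard - X.ncard).choose (p - X.ncard) := by
      calc (Kf C ∩ Kf C').card ≤ (oversets hEfin X (p - X.ncard)).card := Finset.card_le_card hsub
        _ = (M.E.ncard - X.ncard).choose (p - X.ncard) := card_oversets hEfin hXE _
    rcases (show (C ∩ C').ncard = 0 ∨ (C ∩ C').ncard = 1 by omega) with h0 | h1
    · have hX6 : X.ncard = 6 := by omega
      rw [hX6] at hcard
      rw [h0, zero_mul, add_zero]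
      exact hcard
    · have hX5 : X.ncard = 5 := by omega
      rw [hX5] at hcard
      rw [h1, one_mul]
      omega
  have hdelta := sum_ncard_inter_le_delta 𝒯 (fun C hC => hEfin.subset (h𝒯 C hC).1.subset_ground)
    (fun C hC => (h𝒯 C hC).2) hu
  have hbonf := two_mul_sum_card_le_two_mul_card_biUnion_add 𝒯 Kf
  have hsumK : ∑ C ∈ 𝒯, (Kf C).card = 𝒯.card * (M.E.ncard - 3).choose (p - 3) := by
    calc ∑ C ∈ 𝒯, (Kf C).card = ∑ C ∈ 𝒯, (M.E.ncard - 3).choose (p - 3) := by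
          apply Finset.sum_congr rfl
          intro C hC
          show (oversets hEfin C (p - 3)).card = _
          rw [card_oversets hEfin (h𝒯 C hC).1.subset_ground, (h𝒯 C hC).2]
      _ = 𝒯.card * (M.E.ncard - 3).choose (p - 3) := by rw [Finset.sum_const, smul_eq_mul]
  have hsumov : ∑ C ∈ 𝒯, ∑ C' ∈ 𝒯.erase C, (Kf C ∩ Kf C').card ≤
      𝒯.card * (𝒯.card - 1) * o6 + (o5 - o6) * ((3 * 𝒯.card - u) * (3 * 𝒯.card - u + 1)) := by
    calc ∑ C ∈ 𝒯, ∑ C' ∈ 𝒯.erase C, (Kf C ∩ Kf C').card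
        ≤ ∑ C ∈ 𝒯, ∑ C' ∈ 𝒯.erase C, (o6 + (C ∩ C').ncard * (o5 - o6)) := by
          apply Finset.sum_le_sum
          intro C hC
          apply Finset.sum_le_sum
          intro C' hC'
          exact hov C hC C' (Finset.mem_of_mem_erase hC') (Finset.ne_of_mem_erase hC').symm
      _ = ∑ C ∈ 𝒯, ((𝒯.card - 1) * o6 + (∑ C' ∈ 𝒯.erase C, (C ∩ C').ncard) * (o5 - o6)) := by
          apply Finset.sum_congr rfl
          intro C hC
          rw [Finset.sum_add_distrib, Finset.sum_const, Finset.card_erase_of_mem hC, smul_eq_mul, Finset.sum_mul]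
      _ = 𝒯.card * ((𝒯.card - 1) * o6) + (∑ C ∈ 𝒯, ∑ C' ∈ 𝒯.erase C, (C ∩ C').ncard) * (o5 - o6) := by
          rw [Finset.sum_add_distrib, Finset.sum_const, smul_eq_mul, Finset.sum_mul]
      _ ≤ 𝒯.card * ((𝒯.card - 1) * o6) + ((3 * 𝒯.card - u) * (3 * 𝒯.card - u + 1)) * (o5 - o6) := by
          have := Nat.mul_le_mul_right (o5 - o6) hdelta
          omega
      _ = 𝒯.card * (𝒯.card - 1) * o6 + (o5 - o6) * ((3 * 𝒯.card - u) * (3 * 𝒯.card - u + 1)) := by ring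
  set Dh := (3 * 𝒯.card - u) * (3 * 𝒯.card - u + 1) / 2 with hDh
  have hKcard : 𝒯.card * (M.E.ncard - 3).choose (p - 3) ≤
      KK.card + (𝒯.card.choose 2 * o6 + Dh * (o5 - o6)) := by
    have h3 : 𝒯.card * (𝒯.card - 1) = 2 * 𝒯.card.choose 2 := by
      rw [Nat.choose_two_right]
      exact (Nat.two_mul_div_two_of_even (Nat.even_mul_pred_self _)).symm
    have h4 : (3 * 𝒯.card - u) * (3 * 𝒯.card - u + 1) = 2 * Dh :=
      (Nat.two_mul_div_two_of_even (Nat.even_mul_succ_self _)).symm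
    rw [hsumK, ← hKK] at hbonf
    rw [h3, h4] at hsumov
    have h5 : 2 * (𝒯.card * (M.E.ncard - 3).choose (p - 3)) ≤
        2 * KK.card + (2 * 𝒯.card.choose 2 * o6 + (o5 - o6) * (2 * Dh)) :=
      hbonf.trans (Nat.add_le_add_left hsumov _)
    have h6 : 2 * 𝒯.card.choose 2 * o6 + (o5 - o6) * (2 * Dh) =
        2 * (𝒯.card.choose 2 * o6 + Dh * (o5 - o6)) := by ring
    rw [h6] at h5
    omega
  -- `W ∪ KK ⊆ Y ∪ T₃ ∪ T₄`, and `W`, `KK` are disjoint (sizes `< p` versus `= p`)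
  set Y := {A : Set α | A ⊆ M.E ∧ (4 : ℕ∞) < M.eRk A ∧ M.eRk A < (p : ℕ∞)} with hY
  set T₃ := {A : Set α | A ⊆ M.E ∧ M.eRk A ≤ 3 ∧ 5 ≤ A.ncard} with hT₃
  set T₄ := {A : Set α | A ⊆ M.E ∧ M.eRk A = 4 ∧ 5 ≤ A.ncard} with hT₄
  have hclass : ∀ A, A ⊆ M.E → 5 ≤ A.ncard → M.eRk A < (p : ℕ∞) → A ∈ Y ∪ T₃ ∪ T₄ := by
    intro A hAE h5 hlt
    by_cases h4 : (4 : ℕ∞) < M.eRk A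
    · exact Or.inl (Or.inl ⟨hAE, h4, hlt⟩)
    · push Not at h4
      rcases h4.lt_or_eq with h | h
      · have h3 : M.eRk A ≤ 3 := by
          have : M.eRk A < (3 : ℕ∞) + 1 := by rw [show ((3 : ℕ∞) + 1) = 4 by norm_num]; exact h
          simpa using Order.le_of_lt_add_one this
        exact Or.inl (Or.inr ⟨hAE, h3, h5⟩)
      · exact Or.inr ⟨hAE, h, h5⟩
  have hsub : ((W ∪ KK : Finset (Set α)) : Set (Set α)) ⊆ Y ∪ T₃ ∪ T₄ := by
    intro A hA
    rw [Finset.mem_coe, Finset.mem_union] at hA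
    rcases hA with hA | hA
    · obtain ⟨hAE, h5, hlt⟩ := hmemW A hA
      have hAfin : A.Finite := hEfin.subset hAE
      refine hclass A hAE h5 ?_
      calc M.eRk A ≤ A.encard := M.eRk_le_encard A
        _ = (A.ncard : ℕ∞) := hAfin.cast_ncard_eq.symm
        _ < (p : ℕ∞) := by exact_mod_cast hlt
    · obtain ⟨hAE, hAp, C, hC, hCA⟩ := hmemK A hA
      exact hclass A hAE (by omega) (eRk_lt_of_circuit_subset M (h𝒯 C hC).1 hCA hAE hAp)
  have hWK : Disjoint W KK := by
    rw [Finset.disjoint_left]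
    intro A hAW hAK
    have h1 := (hmemW A hAW).2.2
    have h2 := (hmemK A hAK).2.1
    omega
  have hYfin : Y.Finite := hEfin.finite_subsets.subset (fun A hA => hA.1)
  have hT₃fin : T₃.Finite := hEfin.finite_subsets.subset (fun A hA => hA.1)
  have hT₄fin : T₄.Finite := hEfin.finite_subsets.subset (fun A hA => hA.1)
  have hWle : W.card + KK.card ≤ Y.ncard + T₃.ncard + T₄.ncard := by
    calc W.card + KK.card = (W ∪ KK).card := (Finset.card_union_of_disjoint hWK).symm
      _ = ((W ∪ KK : Finset (Set α)) : Set (Set α)).ncard := (Set.ncard_coe_finset _).symm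
      _ ≤ (Y ∪ T₃ ∪ T₄).ncard := Set.ncard_le_ncard hsub ((hYfin.union hT₃fin).union hT₄fin)
      _ ≤ (Y ∪ T₃).ncard + T₄.ncard := Set.ncard_union_le _ _
      _ ≤ Y.ncard + T₃.ncard + T₄.ncard := by
          have := Set.ncard_union_le Y T₃
          omega
  have hmid : Matroid.midCount M p 4 = Y.ncard := rfl
  rw [← hWcard, hmid]
  have hY3' : 5 * T₃.ncard ≤ 7 * ({C : Set α | M.IsCircuit C ∧ C.ncard = 3}.ncard * (M.E.ncard - 3) +
      {C : Set α | M.IsCircuit C ∧ C.ncard = 4}.ncard) := hY3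
  have hY2' : 7560 * T₄.ncard ≤ _ := hY2
  omega

end S1

end PercRepro
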